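import Mathlib.NumberTheory.Harmonic.EulerMascheroni
import Mathlib.NumberTheory.Harmonic.Bounds
import Mathlib.Analysis.Complex.ExponentialBounds
import Mathlib.Analysis.SpecialFunctions.Pow.Real
import Literature.NumberTheory.LFunctions.RHClassicalEquivalents
import Literature.NumberTheory.LFunctions.LagariasNumerical
import HarnessLib

/-!
# Lagarias's criterion: the reduction to Robin's theorems (Lagarias 2002, §3)

Topic: `Literature/NumberTheory/LFunctions`. Companion of the named fact `Literature.NumberTheory.LFunctions.lagarias_iff`
(`RHClassicalEquivalents.lean`, rh.S25): Lagarias's Theorem 1.1, "RH ↔ `σ(n) ≤ H_n + exp(H_n)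
log(H_n)` for every `n ≥ 1`". This file formalises §3 of the paper ("Proofs"), i.e. everything
in the printed proof of Theorem 1.1 *except* its two deep inputs, which are theorems of Robin
(1984) quoted by Lagarias as Propositions 3.1 and 3.2 and recorded here as named facts, and the
finite computer check for `n ≤ 5040`, recorded as a (computational) named fact.

## Contents

* `Robin1984_sigma_le` — NAMED FACT (Lagarias Prop. 3.1 = Robin 1984, Thm. 1): under RH,
  `σ(n) ≤ e^γ n log log n` for every `n ≥ 5041`.
* `Robin1984_sigma_oscillation` — NAMED FACT (Lagarias Prop. 3.2 = Robin 1984, §4, Prop. 1): if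
  RH fails, there are `0 < β < 1/2` and `C > 0` with
  `σ(n) ≥ e^γ n log log n + C n log log n / (log n)^β` for infinitely many `n`.
* `Lagarias2002_numerical_le_5040` — NAMED FACT (Lagarias, proof of Thm. 1.1: "for
  `1 ≤ n ≤ 5040` one verifies (1.1) directly by computer"): the inequality for `n ≤ 5040`.
* `Lagarias2002_lemma_3_1` (proved) — Lemma 3.1: `e^γ n log log n ≤ exp(H_n) log(H_n)` for
  `n ≥ 3`.
* `Lagarias2002_lemma_3_2` (proved) — Lemma 3.2: `H_n + exp(H_n) log(H_n) ≤ e^γ n log log n +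
  7 n / log n` (the paper states it for `n ≥ 20`; the proof below gives it for `n ≥ 2`).
* `lagarias_iff_of_robin` (proved) — the printed proof of Theorem 1.1: the three named facts
  imply `Literature.NumberTheory.LFunctions.lagarias_iff`.
* `Robin1984_sigma_le_of_robin_iff` (proved) — the first named fact is the forward direction of
  the tree's named fact `Literature.NumberTheory.LFunctions.robin_iff` (Robin's criterion), so a discharge of `robin_iff`
  discharges it.
* `Lagarias2002_numerical_le_5040_holds` (proved) — DISCHARGE of the computational named fact,
  by the kernel-certified computation of `LagariasNumerical.lean`
  (`Literature.NumberTheory.LFunctions.sigma_le_harmonic_add_exp_mul_log_of_le_5040`).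
* `lagarias_iff_of_robin'` (proved) — Theorem 1.1 from the two theorems of Robin alone.

What remains for `lagarias_iff_holds` is exactly Robin 1984: `lagarias_iff_of_robin'
Robin1984_sigma_le_holds Robin1984_sigma_oscillation_holds` once those two deep facts (Robin's
Thm. 1 under RH, and the `Ω₊` oscillation of `σ(n)/(n log log n)` if RH fails) are discharged.

## Sources

* J. C. Lagarias, *An elementary problem equivalent to the Riemann hypothesis*, Amer. Math.
  Monthly 109 (2002), 534–543 (arXiv:math/0008177), §3: Prop. 3.1, Prop. 3.2, Lemma 3.1,
  Lemma 3.2, proof of Thm. 1.1.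
* G. Robin, *Grandes valeurs de la fonction somme des diviseurs et hypothèse de Riemann*, J. Math.
  Pures Appl. 63 (1984), 187–213: Thm. 1 (§1) and §4, Prop. 1.

## Design choices

* Prop. 3.1 is vendored with the non-strict `≤` printed by Lagarias (Robin's Thm. 1 has `<`; the
  weaker form is what the proof of Thm. 1.1 uses, and it is implied by `Literature.NumberTheory.LFunctions.robin_iff`).
* "for infinitely many `n`" is `∃ᶠ n : ℕ in atTop, …` (`Nat.frequently_atTop_iff_infinite`).
* `(log n)^β` with real `β` is `Real.rpow`.
* The statement of `Literature.NumberTheory.LFunctions.lagarias_iff` omits the paper's clause "with equality only for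
  `n = 1`"; the printed proof of "(1.1) for all `n` ⇒ RH" uses only the non-strict inequality
  (Lemma 3.2 vs Prop. 3.2), so the vendored equivalence is exactly what §3 proves.
-/

noncomputable section

open Filter Real
open scoped Topology

namespace Literature.NumberTheory.LFunctions

/-! ### The two theorems of Robin used by Lagarias (named facts) -/

/-- NAMED FACT (Lagarias 2002, Prop. 3.1, quoting Robin 1984, Thm. 1: "If the Riemann hypothesis
is true, then for each `n ≥ 5041`, `∑_{d ∣ n} d ≤ e^γ n log log n`, where `γ` is Euler's
constant"). Here `σ = ArithmeticFunction.sigma 1`, `γ = Real.eulerMascheroniConstant`. Robin's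
own statement has strict inequality (cf. `Literature.NumberTheory.LFunctions.robin_iff`); the non-strict form printed by
Lagarias is what his proof consumes. Users take `(h : Robin1984_sigma_le)`.
[cite: Lagarias2002, Prop. 3.1 (= Robin1984, Thm. 1)] -/
def Robin1984_sigma_le : Prop :=
  RiemannHypothesis → ∀ n : ℕ, 5041 ≤ n →
    (ArithmeticFunction.sigma 1 n : ℝ) ≤ exp eulerMascheroniConstant * n * log (log n)

/-- NAMED FACT (Lagarias 2002, Prop. 3.2, quoting Robin 1984, §4, Prop. 1: "If the Riemann
hypothesis is false, then there exist constants `0 < β < 1/2` and `C > 0` such that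
`∑_{d ∣ n} d ≥ e^γ n log log n + C n log log n / (log n)^β` holds for infinitely many `n`";
`β` may be taken anywhere in `(1 - b, 1/2)` for a zero `ρ` of `ζ` with `b = Re ρ > 1/2`, and
`C` small depending on `ρ` — method of Nicolas/Landau). "Infinitely many `n`" is phrased with
`∃ᶠ n in atTop`. Users take `(h : Robin1984_sigma_oscillation)`.
[cite: Lagarias2002, Prop. 3.2 (= Robin1984, §4 Prop. 1)] -/
def Robin1984_sigma_oscillation : Prop :=
  ¬ RiemannHypothesis → ∃ β C : ℝ, 0 < β ∧ β < 1 / 2 ∧ 0 < C ∧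
    ∃ᶠ n : ℕ in atTop,
      exp eulerMascheroniConstant * n * log (log n) + C * n * log (log n) / log n ^ β ≤
        (ArithmeticFunction.sigma 1 n : ℝ)

/-- NAMED FACT, computational (Lagarias 2002, proof of Thm. 1.1: "For `1 ≤ n ≤ 5040` one
verifies (1.1) directly by computer, the only case of equality being `n = 1`"; the check is
credited to E. Rains). For `1 ≤ n ≤ 5040`, `σ(n) ≤ H_n + exp(H_n) log(H_n)` with
`H_n = harmonic n`. (The margin is small at the highly composite numbers: about 1% at `n = 12`,
2.2% at `n = 2520`, 2.5% at `n = 5040`, where Robin's inequality itself fails.) A finite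
certified computation; users take `(h : Lagarias2002_numerical_le_5040)`.
[cite: Lagarias2002, §3, proof of Thm. 1.1 (computer check for n ≤ 5040)] -/
def Lagarias2002_numerical_le_5040 : Prop :=
  ∀ n : ℕ, 1 ≤ n → n ≤ 5040 →
    (ArithmeticFunction.sigma 1 n : ℝ) ≤ (harmonic n : ℝ) + exp (harmonic n : ℝ) * log (harmonic n : ℝ)

/-! ### Elementary lemmas on harmonic numbers (Lagarias 2002, Lemmas 3.1 and 3.2) -/

/-- `log n + γ < H_n` for `n ≥ 1` (Lagarias 2002, (3.5): `H_n = log n + γ + ∫_n^∞ {t}/t² dt`);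
Mathlib: `γ < eulerMascheroniSeq' n = H_n - log n`. [cite: Lagarias2002, §3 eq. (3.5)] -/
theorem log_add_eulerMascheroniConstant_lt_harmonic {n : ℕ} (hn : n ≠ 0) :
    log n + eulerMascheroniConstant < (harmonic n : ℝ) := by
  have h := eulerMascheroniConstant_lt_eulerMascheroniSeq' n
  simp only [eulerMascheroniSeq', hn, if_false] at h
  linarith

/-- `H_n < log (n + 1) + γ` (Mathlib: `eulerMascheroniSeq n = H_n - log (n+1) < γ`).
[cite: Lagarias2002, §3 eq. (3.5)] -/
theorem harmonic_lt_log_add_one_add_eulerMascheroniConstant (n : ℕ) :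
    (harmonic n : ℝ) < log (n + 1) + eulerMascheroniConstant := by
  have h := eulerMascheroniSeq_lt_eulerMascheroniConstant n
  simp only [eulerMascheroniSeq] at h
  linarith

/-- `e^γ < 2` (from Mathlib's `γ < 2/3` and `log 2 > 0.6931`). [folklore] -/
theorem exp_eulerMascheroniConstant_lt_two : exp eulerMascheroniConstant < 2 := by
  have h1 : eulerMascheroniConstant < log 2 := by
    have := eulerMascheroniConstant_lt_two_thirds
    have := log_two_gt_d9
    linarith
  calc exp eulerMascheroniConstant < exp (log 2) := exp_lt_exp.2 h1
    _ = 2 := exp_log two_pos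

/-- `1 < log n` for `n ≥ 3` (since `e < 3`). [folklore] -/
theorem one_lt_log_natCast {n : ℕ} (hn : 3 ≤ n) : 1 < log n := by
  have hn0 : (0 : ℝ) < n := by exact_mod_cast (show 0 < n by omega)
  rw [lt_log_iff_exp_lt hn0]
  calc exp 1 < 2.7182818286 := exp_one_lt_d9
    _ < 3 := by norm_num
    _ ≤ n := by exact_mod_cast hn

/-- **Lagarias 2002, Lemma 3.1.** For `n ≥ 3`, `e^γ n log log n ≤ exp(H_n) log(H_n)`.
Proof as printed: `H_n > log n + γ` gives `exp(H_n) ≥ e^γ n`, and `H_n ≥ log n > 1` gives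
`log H_n ≥ log log n > 0`. [cite: Lagarias2002, Lemma 3.1] -/
theorem Lagarias2002_lemma_3_1 {n : ℕ} (hn : 3 ≤ n) :
    exp eulerMascheroniConstant * n * log (log n) ≤
      exp (harmonic n : ℝ) * log (harmonic n : ℝ) := by
  set H : ℝ := (harmonic n : ℝ) with hHdef
  have hn0 : (0 : ℝ) < n := by exact_mod_cast (show 0 < n by omega)
  have hlogn : 1 < log n := one_lt_log_natCast hn
  have hH : log n + eulerMascheroniConstant < H :=
    log_add_eulerMascheroniConstant_lt_harmonic (by omega)
  have hγ : 0 < eulerMascheroniConstant :=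
    lt_trans (by norm_num) one_half_lt_eulerMascheroniConstant
  have hexp : exp eulerMascheroniConstant * n ≤ exp H := by
    calc exp eulerMascheroniConstant * n
        = exp (eulerMascheroniConstant + log n) := by rw [exp_add, exp_log hn0]
      _ ≤ exp H := exp_le_exp.2 (by linarith)
  have hlogH : log (log n) ≤ log H := log_le_log (by linarith) (by linarith)
  have hLL : 0 ≤ log (log n) := log_nonneg hlogn.le
  calc exp eulerMascheroniConstant * n * log (log n)
      ≤ exp H * log (log n) := mul_le_mul_of_nonneg_right hexp hLL
    _ ≤ exp H * log H := mul_le_mul_of_nonneg_left hlogH (exp_pos _).le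

/-- **Lagarias 2002, Lemma 3.2** (stated there for `n ≥ 20`; proved here for `n ≥ 2`).
`H_n + exp(H_n) log(H_n) ≤ e^γ n log log n + 7 n / log n`. Proof (the printed one, with
Mathlib's `H_n < log(n+1) + γ` in place of (3.8)–(3.9)): `H_n ≤ log n + 1`,
`log H_n ≤ log(log n + 1) ≤ log log n + 1/log n`, `exp(H_n) ≤ e^γ (n + 1)`, `e^γ < 2`, and
`(log n)² ≤ n`. [cite: Lagarias2002, Lemma 3.2] -/
theorem Lagarias2002_lemma_3_2 {n : ℕ} (hn : 2 ≤ n) :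
    (harmonic n : ℝ) + exp (harmonic n : ℝ) * log (harmonic n : ℝ) ≤
      exp eulerMascheroniConstant * n * log (log n) + 7 * n / log n := by
  set H : ℝ := (harmonic n : ℝ) with hHdef
  set G : ℝ := exp eulerMascheroniConstant with hGdef
  set L : ℝ := log n with hLdef
  have hn0 : (0 : ℝ) < n := by exact_mod_cast (show 0 < n by omega)
  have hn1 : (1 : ℝ) < n := by exact_mod_cast (show 1 < n by omega)
  have hn1' : (1 : ℝ) ≤ n := hn1.le
  have hL : 0 < L := log_pos hn1
  have hGpos : 0 < G := exp_pos _
  have hG2 : G < 2 := exp_eulerMascheroniConstant_lt_two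
  -- `H ≤ 1 + log n` (Lagarias (3.4)); Mathlib `harmonic_le_one_add_log`.
  have hHle : H ≤ 1 + L := harmonic_le_one_add_log n
  -- `1 < H`: `log 3 ≤ log (n + 1) ≤ H`.
  have hH1 : 1 < H := by
    have h1 : log ((n + 1 : ℕ) : ℝ) ≤ H := log_add_one_le_harmonic n
    have h2 : 1 < log ((n + 1 : ℕ) : ℝ) := one_lt_log_natCast (by omega)
    linarith
  have hlogH0 : 0 ≤ log H := log_nonneg hH1.le
  -- `exp H ≤ e^γ (n + 1)`.
  have hexpH : exp H ≤ G * (n + 1) := by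
    have h := harmonic_lt_log_add_one_add_eulerMascheroniConstant n
    calc exp H ≤ exp (log (n + 1) + eulerMascheroniConstant) := exp_le_exp.2 h.le
      _ = G * (n + 1) := by rw [exp_add, exp_log (by linarith), mul_comm]
  -- `log H ≤ log log n + 1 / log n`.
  have hlogH : log H ≤ log L + 1 / L := by
    have h1 : log H ≤ log (1 + L) := log_le_log (by linarith) hHle
    have h2 : log (1 + L) ≤ log L + 1 / L := by
      rw [log_le_iff_le_exp (by linarith), exp_add, exp_log hL]
      have h3 := add_one_le_exp (1 / L)
      have h4 : L * (1 / L + 1) ≤ L * exp (1 / L) := mul_le_mul_of_nonneg_left h3 hL.le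
      have h5 : L * (1 / L + 1) = 1 + L := by field_simp
      linarith
    linarith
  -- `log log n ≤ log n - 1` and `(log n)^2 ≤ n`.
  have hLL : log L ≤ L - 1 := log_le_sub_one_of_pos hL
  have hLsq : L ^ 2 ≤ n := by
    have he : 2 ≤ exp 1 := by linarith [add_one_le_exp (1 : ℝ)]
    have hs0 : 0 ≤ √(n : ℝ) := sqrt_nonneg _
    have hspos : 0 < √(n : ℝ) / exp 1 := div_pos (sqrt_pos.2 hn0) (exp_pos 1)
    have h1 : log (√(n : ℝ) / exp 1) ≤ √(n : ℝ) / exp 1 - 1 := log_le_sub_one_of_pos hspos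
    have h2 : log (√(n : ℝ) / exp 1) = L / 2 - 1 := by
      rw [log_div (sqrt_pos.2 hn0).ne' (exp_pos 1).ne', log_exp, log_sqrt hn0.le]
    have h3 : L ≤ 2 * (√(n : ℝ) / exp 1) := by linarith
    have h4 : 2 * (√(n : ℝ) / exp 1) ≤ √(n : ℝ) := by
      rw [mul_div_assoc', div_le_iff₀ (exp_pos 1)]
      nlinarith
    calc L ^ 2 ≤ (√(n : ℝ)) ^ 2 := pow_le_pow_left₀ hL.le (h3.trans h4) 2
      _ = n := sq_sqrt hn0.le
  -- the key polynomial inequality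
  have hQ : 0 ≤ n / L + (L - 1) + 1 / L := by
    have h1 : 0 < n / L := div_pos hn0 hL
    have h2 : 0 ≤ (L - 1) + 1 / L := by
      have : (L - 1) + 1 / L = ((L - 1) ^ 2 + (L - 1) + 1) / L := by field_simp; ring
      rw [this]
      exact div_nonneg (by nlinarith) hL.le
    linarith
  have hkey : 1 + L + G * (n / L + (L - 1) + 1 / L) ≤ 7 * n / L := by
    have h1 : G * (n / L + (L - 1) + 1 / L) ≤ 2 * (n / L + (L - 1) + 1 / L) :=
      mul_le_mul_of_nonneg_right hG2.le hQ
    have h2 : 1 + L + 2 * (n / L + (L - 1) + 1 / L) ≤ 7 * n / L := by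
      rw [le_div_iff₀ hL]
      have : (1 + L + 2 * (n / L + (L - 1) + 1 / L)) * L = 3 * L ^ 2 - L + 2 * n + 2 := by
        field_simp
        ring
      rw [this]
      nlinarith
    linarith
  -- assemble
  have hstep : exp H * log H ≤ G * (n + 1) * (log L + 1 / L) :=
    mul_le_mul hexpH hlogH hlogH0 (by positivity)
  calc H + exp H * log H ≤ (1 + L) + G * (n + 1) * (log L + 1 / L) := add_le_add hHle hstep
    _ = G * n * log L + (1 + L + G * (n / L + log L + 1 / L)) := by
      field_simp
      ring
    _ ≤ G * n * log L + (1 + L + G * (n / L + (L - 1) + 1 / L)) := by gcongr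
    _ ≤ G * n * log L + 7 * n / L := by linarith [hkey]

/-! ### Theorem 1.1 from the named facts -/

/-- **Lagarias 2002, Thm. 1.1, as printed** (the reduction): Robin's two theorems (Props. 3.1,
3.2) and the computer check for `n ≤ 5040` imply Lagarias's criterion `Literature.NumberTheory.LFunctions.lagarias_iff`.
(⇐ of the criterion, i.e. RH ⇒ (1.1)): for `n ≥ 5041`, Prop. 3.1 and Lemma 3.1; for `n ≤ 5040`
the check. (⇒): if (1.1) holds for all `n` but RH fails, Prop. 3.2 gives infinitely many `n` with
`C n log log n / (log n)^β ≤ 7 n / log n` (Lemma 3.2), impossible since `β < 1/2 < 1` and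
`log log n → ∞`. [cite: Lagarias2002, Thm. 1.1 (proof, §3)] -/
theorem lagarias_iff_of_robin (h₁ : Robin1984_sigma_le) (h₂ : Robin1984_sigma_oscillation)
    (h₃ : Lagarias2002_numerical_le_5040) : lagarias_iff := by
  constructor
  · -- RH ⇒ (1.1) for all `n ≥ 1`
    intro hRH n hn
    by_cases h5040 : n ≤ 5040
    · exact h₃ n hn h5040
    · have hn' : 5041 ≤ n := by omega
      have hHpos : 0 ≤ (harmonic n : ℝ) := by
        have := log_add_eulerMascheroniConstant_lt_harmonic (n := n) (by omega)
        have := one_lt_log_natCast (n := n) (by omega)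
        linarith [one_half_lt_eulerMascheroniConstant]
      calc (ArithmeticFunction.sigma 1 n : ℝ) ≤ exp eulerMascheroniConstant * n * log (log n) := h₁ hRH n hn'
        _ ≤ exp (harmonic n : ℝ) * log (harmonic n : ℝ) := Lagarias2002_lemma_3_1 (by omega)
        _ ≤ (harmonic n : ℝ) + exp (harmonic n : ℝ) * log (harmonic n : ℝ) :=
          le_add_of_nonneg_left hHpos
  · -- (1.1) for all `n ≥ 1` ⇒ RH
    intro hE
    by_contra hRH
    obtain ⟨β, C, hβ0, hβ, hC, hfreq⟩ := h₂ hRH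
    -- eventually, `7 n / log n < C n log log n / (log n)^β`
    have hev : ∀ᶠ n : ℕ in atTop, 3 ≤ n ∧ 7 / C < log (log n) := by
      refine (eventually_ge_atTop 3).and ?_
      have ht : Tendsto (fun n : ℕ ↦ log (log n)) atTop atTop :=
        tendsto_log_atTop.comp (tendsto_log_atTop.comp tendsto_natCast_atTop_atTop)
      exact ht.eventually (eventually_gt_atTop (7 / C))
    obtain ⟨n, hσ, hn3, hLL⟩ := (hfreq.and_eventually hev).exists
    set G : ℝ := exp eulerMascheroniConstant with hGdef
    set L : ℝ := log n with hLdef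
    have hn0 : (0 : ℝ) < n := by exact_mod_cast (show 0 < n by omega)
    have hL1 : 1 < L := one_lt_log_natCast hn3
    have hL0 : 0 < L := by linarith
    have hLL0 : 0 < log L := log_pos hL1
    -- upper bound from (1.1) and Lemma 3.2
    have hup : (ArithmeticFunction.sigma 1 n : ℝ) ≤ G * n * log L + 7 * n / L :=
      (hE n (by omega)).trans (Lagarias2002_lemma_3_2 (by omega))
    -- so `C n log log n / (log n)^β ≤ 7 n / log n`
    have h1 : C * n * log L / L ^ β ≤ 7 * n / L := by linarith
    -- but `(log n)^β ≤ log n` and `C log log n > 7`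
    have hLβ : L ^ β ≤ L := by
      calc L ^ β ≤ L ^ (1 : ℝ) := rpow_le_rpow_of_exponent_le hL1.le (by linarith)
        _ = L := rpow_one L
    have hLβpos : 0 < L ^ β := rpow_pos_of_pos hL0 β
    have h2 : C * n * log L / L ≤ C * n * log L / L ^ β :=
      div_le_div_of_nonneg_left (by positivity) hLβpos hLβ
    have h3 : 7 * n / L < C * n * log L / L := by
      rw [div_lt_div_iff_of_pos_right hL0]
      have h4 : 7 < C * log L := by
        have := (div_lt_iff₀ hC).1 hLL
        linarith [this]
      nlinarith
    linarith

/-! ### Links and discharges -/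

/-- The named fact `Robin1984_sigma_le` (Lagarias's Prop. 3.1, non-strict, `n ≥ 5041`) is the
forward direction of Robin's criterion `Literature.NumberTheory.LFunctions.robin_iff` (strict, `n > 5040`); recorded so that
a discharge of `robin_iff` discharges it (review of p4265).
[cite: Lagarias2002, Prop. 3.1 (= Robin1984, Thm. 1)] -/
theorem Robin1984_sigma_le_of_robin_iff (h : robin_iff) : Robin1984_sigma_le :=
  fun hRH n hn => (h.1 hRH n (by omega)).le

/-- DISCHARGE of the computational named fact `Lagarias2002_numerical_le_5040` ("for
`1 ≤ n ≤ 5040` one verifies (1.1) directly by computer"): the kernel-certified computation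
`Literature.NumberTheory.LFunctions.sigma_le_harmonic_add_exp_mul_log_of_le_5040` of `LagariasNumerical.lean` (sixteen
certified checkpoint bounds and an exact evaluation of `σ` on `[1, 5040]`, standard axioms only).
[cite: Lagarias2002, §3, proof of Thm. 1.1 (computer check for n ≤ 5040)] -/
theorem Lagarias2002_numerical_le_5040_holds : Lagarias2002_numerical_le_5040 :=
  sigma_le_harmonic_add_exp_mul_log_of_le_5040

/-- **Lagarias 2002, Thm. 1.1** from Robin's two theorems alone (the computer check being
discharged): `Robin1984_sigma_le → Robin1984_sigma_oscillation → lagarias_iff`.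
[cite: Lagarias2002, Thm. 1.1 (proof, §3)] -/
theorem lagarias_iff_of_robin' (h₁ : Robin1984_sigma_le) (h₂ : Robin1984_sigma_oscillation) :
    lagarias_iff :=
  lagarias_iff_of_robin h₁ h₂ Lagarias2002_numerical_le_5040_holds

end Literature.NumberTheory.LFunctions

end
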